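import Literature.RepresentationTheory.KonnoKonno2007.FockModelUnitaryDualPair
import Literature.NumberTheory.Weil1964.ArchWeilCirclePin
import Literature.NumberTheory.Weil1964.ArchWeilUnipotentPin
import Literature.NumberTheory.Weil1964.ArchWeilDatumConj
import HarnessLib

/-!
# The vacuum zero-point weight at a dual-pair junction: `2η(e_P − e_Q) = ∓ tr(b)`

Kernel leaf (no records, no `def … : Prop`; the print row `FockVacuumCharacter` of
`KonnoKonno2007/FockModelUnitaryDualPair` enters §3 only as a HYPOTHESIS).  For a junction datum
`D : RealDualPairJunction P Q R S Ginf` ([KonnoKonno2007, §3.1]: `Ginf = G_V × G_W`, `κ` the maximal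
compact `(U(P)×U(Q))×(U(R)×U(S))`):

* §1 `suCircle p₀ q₀ θ = ((e^{iθ} at p₀ ∈ P, e^{−iθ} at q₀ ∈ Q), (1, 1)) ∈ K_V × K_W` — the compact
  circle of the `SU(1,1)` of a hyperbolic plane `ℂv⁺_{p₀} ⊕ ℂv⁻_{q₀} ⊂ V` — and its determinant-power
  scalar `vacScalar_suCircle(_zmul) : vacScalar e (suCircle p₀ q₀ (ηθ)) = e^{iη(e_P − e_Q)θ}`.
* §2 for ANY covariant realisation `(ι𝕎, ω)` of `Ginf` (`IsArchWeilDatum ι𝕎 ω`) and `κ : K_V × K_W →* Ginf`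
  such that the Gaussian vacuum `h₀` transforms under `κ` by `vacScalar e` (the vacuum clause of
  `FockVacuumCharacter D e`) and ANY `φ : SL(2,ℝ) →* Ginf` whose rotations run through
  `κ (suCircle p₀ q₀ (η ·))` (`η : ℤ`, orientation `±1`)
  and whose lower (resp. upper) shears act by the Siegel chirps of a real direction `b`:
  `two_mul_eP_sub_eQ_eq_neg_trace : 2η(e_P − e_Q) = −tr(b)` (resp. `two_mul_eP_sub_eQ_eq_trace :
  … = tr(b)`) — `IsArchWeilDatum.two_mul_weight_eq(_neg)_trace` of `Weil1964/ArchWeilCirclePin` with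
  the circle character computed here.
* §3 at the record: `RealDualPairJunction.FockVacuumCharacter.two_mul_zmul_eP_sub_eQ_eq(_neg)_trace` —
  the chirp action is DERIVED by the unipotent pin `IsArchWeilDatum.apply_eq_chirpS`
  (`Weil1964/ArchWeilUnipotentPin`) from the symplectic matrices of `φ L(y)` / `φ U(y)` and of the split
  torus element `φ D(½)` / `φ D(2)` (`§0`: `slLower_add`, `slDiag_conj_slLower`) read in a unitarily
  ROTATED Lagrangian frame `u ∈ U(DPIdx)` (`IsArchWeilDatum.conj_unitary`, `Weil1964/ArchWeilDatumConj`;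
  the vacuum scalars are frame-independent), so the remaining hypotheses are `D.FockVacuumCharacter e`,
  the circle identity in `K_V × K_W`, and MATRIX IDENTITIES in `Sp(𝕎)` about
  `realifySp u · D.ι𝕎 (φ ·) · (realifySp u)⁻¹`.

* §4 projection form `…two_mul_zmul_eP_sub_eQ_eq_neg_trace_of_proj` / `…zmul_eP_sub_eQ_eq_neg_one`:
  when `b` is a symmetric idempotent (an orthogonal coordinate projection) the split-torus data are
  supplied here (`projHalf b = 1 − ½ b`, `projDouble b = 1 + b`, `(1 + b) b (1 − ½ b)⁻¹ = 4b`), so the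
  instance states only `hιu`, `hιd : φ D(½) ↦ (p − ½ b p, q + b q)` and, for the last form, `tr b = 2`
  `⇒ η (e_P − e_Q) = −1`.

* §5 signed-projection form `…two_mul_zmul_eP_sub_eQ_eq_neg_trace_of_absorb`: the same with `b`
  absorbed by a symmetric idempotent `Π` (`bΠ = Πb = b`; `b = Π_S − Π_R`, `Π = Π_S + Π_R` for a
  hyperbolic plane of `V` tensored with `W` of signature `(|R|, |S|)`), `φ D(½) ↦ (p − ½ Π p, q + Π q)`
  `⇒ 2η(e_P − e_Q) = −tr b` (`= 2|R| − 2|S|` there).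

For the literal `SU(1,1) ≅ SL₂(ℝ)` of a hyperbolic plane (`b = 1` on its two real `p`-coordinates in a
Lagrangian polarisation, `tr b = 2`) this reads `e_P − e_Q = ∓η = ∓1`: the consistency pin of the print
row against [KonnoKonno2007, Lemma 5.2] (`kk07Reading_eP_sub_eQ = ε(q′ − p′)`).

Sources followed for conventions (nothing cited as a fact): G. B. Folland, *Harmonic Analysis in Phase
Space* (1989) Ch. 4 (Gaussian vacuum, metaplectic generators); K. Konno, T. Konno (2007) §3.1 (the
junction), Lemma 5.2 p. 73 (determinant powers).
-/

set_option autoImplicit false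

noncomputable section

open MeasureTheory Complex SchwartzMap Matrix Filter Topology
open scoped Real

/-! ## 0. Supplements on `SL(2,ℝ)`: the lower shear group and its dilation relation -/

namespace Literature.LinearAlgebra.Matrix.RotationThreeShears

/-- `L(x + y) = L(x) L(y)`. [folklore] -/
theorem slLower_add (x y : ℝ) : slLower (x + y) = slLower x * slLower y := by
  ext i j
  simp only [coe_slLower, Matrix.SpecialLinearGroup.coe_mul]
  fin_cases i <;> fin_cases j <;> simp [lowerShear, Matrix.mul_apply, Fin.sum_univ_two]

/-- `D(a) · L(y) = L(a⁻² y) · D(a)`. [folklore] -/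
theorem slDiag_mul_slLower (a : ℝ) (ha : a ≠ 0) (y : ℝ) :
    slDiag a ha * slLower y = slLower ((a ^ 2)⁻¹ * y) * slDiag a ha := by
  ext i j
  simp only [Matrix.SpecialLinearGroup.coe_mul, coe_slDiag, coe_slLower]
  fin_cases i <;> fin_cases j <;> simp [lowerShear, Matrix.mul_apply, Fin.sum_univ_two]
  field_simp

/-- the dilation relation for lower shears `D(a) · L(y) · D(a)⁻¹ = L(a⁻² y)` (e.g. `a = 1/2`:
`D(½) L(y) D(½)⁻¹ = L(4y)`). [folklore] -/
theorem slDiag_conj_slLower (a : ℝ) (ha : a ≠ 0) (y : ℝ) :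
    slDiag a ha * slLower y * (slDiag a ha)⁻¹ = slLower ((a ^ 2)⁻¹ * y) := by
  rw [mul_inv_eq_iff_eq_mul, slDiag_mul_slLower]

/-- `slWeyl = slRot (π/2)`. [folklore] -/
theorem slWeyl_eq_slRot : slWeyl = slRot (π / 2) :=
  Subtype.ext weyl_eq_rot

end Literature.LinearAlgebra.Matrix.RotationThreeShears

namespace Literature.RepresentationTheory.KonnoKonno2007

open Literature.Analysis.SegalBargmann Literature.RepresentationTheory.HeisenbergGroup
open Literature.NumberTheory.Weil1964 Literature.LinearAlgebra.Matrix

/-! ## 1. The compact circle of an `SU(1,1)` and its determinant-power character -/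

section Circle

variable {σ : Type*} [Fintype σ] [DecidableEq σ]

/-- the circle coordinate `θ ↦ (1,…, e^{iθ} at l₀, …, 1) ∈ (S¹)^σ`. [folklore] -/
def circleAt (l₀ : σ) (θ : ℝ) : σ → Circle :=
  Function.update (fun _ => 1) l₀ (Circle.exp θ)

/-- `∏_l circleAt l₀ θ l = e^{iθ}` (as complex numbers). [folklore] -/
theorem prod_coe_circleAt (l₀ : σ) (θ : ℝ) :
    ∏ l, ((circleAt l₀ θ l : Circle) : ℂ) = cexp ((θ : ℂ) * I) := by
  rw [← Circle.coe_exp]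
  have : (fun l => ((circleAt l₀ θ l : Circle) : ℂ)) =
      Function.update (fun _ => (1 : ℂ)) l₀ ((Circle.exp θ : Circle) : ℂ) := by
    funext l
    by_cases h : l = l₀
    · subst h; simp [circleAt]
    · simp [circleAt, h]
  rw [this, Finset.prod_update_of_mem (Finset.mem_univ l₀)]
  simp

/-- determinant of the circle coordinate: `det (diag (circleAt l₀ θ)) = e^{iθ}`. [folklore] -/
theorem det_diagHom_circleAt (l₀ : σ) (θ : ℝ) :
    ((diagHom (circleAt l₀ θ) : Matrix.unitaryGroup σ ℂ) : Matrix σ σ ℂ).det = cexp ((θ : ℂ) * I) := by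
  rw [coe_diagHom, Matrix.det_diagonal, prod_coe_circleAt]

/-- the circle scalar `e^{i m θ}` has norm one. [folklore] -/
theorem norm_cexp_I_mul_int_mul (m : ℤ) (θ : ℝ) : ‖cexp (I * (m : ℂ) * (θ : ℂ))‖ = 1 := by
  rw [show I * (m : ℂ) * (θ : ℂ) = ((m * θ : ℝ) : ℂ) * I by push_cast; ring, Complex.norm_exp_ofReal_mul_I]

end Circle

variable {P Q R S : Type*} [Fintype P] [DecidableEq P] [Fintype Q] [DecidableEq Q] [Fintype R]
  [DecidableEq R] [Fintype S] [DecidableEq S]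
variable {Ginf : Type*} [Group Ginf] [TopologicalSpace Ginf]

local notation "SR" σ => SchwartzMap (σ → ℝ) ℂ
local notation "SpR" σ => symplecticGroup (polar (dotPairing σ))

/-- **The compact circle** of the `SU(1,1)` of a hyperbolic plane `ℂv⁺ ⊕ ℂv⁻ ⊂ V` (`v⁺ ∈ V⁺` the
basis vector `p₀`, `v⁻ ∈ V⁻` the basis vector `q₀`): `θ ↦ ((e^{iθ} at p₀, e^{−iθ} at q₀), (1, 1))` in
`K_V × K_W = (U(P)×U(Q))×(U(R)×U(S))`. [folklore] -/
def suCircle (p₀ : P) (q₀ : Q) (θ : ℝ) : DPK P Q R S :=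
  ((diagHom (circleAt p₀ θ), diagHom (circleAt q₀ (-θ))), (1, 1))

/-- **The determinant-power scalar on the circle**:
`vacScalar e (suCircle p₀ q₀ θ) = e^{i (e_P − e_Q) θ}`. [folklore] -/
theorem vacScalar_suCircle (e : VacExponents) (p₀ : P) (q₀ : Q) (θ : ℝ) :
    vacScalar e (suCircle p₀ q₀ θ : DPK P Q R S) = cexp (I * ((e.eP - e.eQ : ℤ) : ℂ) * (θ : ℂ)) := by
  simp only [vacScalar, suCircle, det_diagHom_circleAt, OneMemClass.coe_one, Matrix.det_one,
    _root_.one_zpow, mul_one]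
  rw [← Complex.exp_int_mul, ← Complex.exp_int_mul, ← Complex.exp_add]
  congr 1
  push_cast
  ring

/-- the circle run through at integer speed `η` (orientation `η = ±1`, or any covering degree):
`vacScalar e (suCircle p₀ q₀ (η θ)) = e^{i η (e_P − e_Q) θ}`. [folklore] -/
theorem vacScalar_suCircle_zmul (e : VacExponents) (p₀ : P) (q₀ : Q) (η : ℤ) (θ : ℝ) :
    vacScalar e (suCircle p₀ q₀ ((η : ℝ) * θ) : DPK P Q R S) =
      cexp (I * ((η * (e.eP - e.eQ) : ℤ) : ℂ) * (θ : ℂ)) := by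
  rw [vacScalar_suCircle]
  congr 1
  push_cast
  ring

/-! ## 2. The pin for a covariant realisation with a `K_V × K_W`-eigen-vacuum -/

/-- **Zero-point pin, lower-shear form.**  For ANY covariant realisation `(ι𝕎, ω)` of `Ginf` and any
homomorphism `κ : K_V × K_W →* Ginf`: if the vacuum transforms under `κ` by `vacScalar e`, the rotations
of `φ : SL(2,ℝ) →* Ginf` run through the compact circle `κ (suCircle p₀ q₀ (η ·))` (`η : ℤ`,
orientation `±1`), and the LOWER shears `φ L(y)` act by the chirps `chirpS (y • b)`, then
`2 η (e_P − e_Q) = −tr(b)`. [folklore] -/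
theorem two_mul_eP_sub_eQ_eq_neg_trace {ι𝕎 : Ginf →* SpR (DPIdx P Q R S)}
    {ω : Representation ℂ Ginf (SR (DPIdx P Q R S))} (hW : IsArchWeilDatum ι𝕎 ω)
    (κ : DPK P Q R S →* Ginf) (e : VacExponents)
    (hvac : ∀ k : DPK P Q R S, ω (κ k) (hermitePi 0) = vacScalar e k • hermitePi 0)
    (φ : Matrix.SpecialLinearGroup (Fin 2) ℝ →* Ginf) (p₀ : P) (q₀ : Q) (η : ℤ)
    (hφ : ∀ θ : ℝ, φ (RotationThreeShears.slRot θ) = κ (suCircle p₀ q₀ ((η : ℝ) * θ)))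
    {b : (DPIdx P Q R S → ℝ) →ₗ[ℝ] (DPIdx P Q R S → ℝ)}
    (hu : ∀ (y : ℝ) (f : SR (DPIdx P Q R S)),
      ω (φ (RotationThreeShears.slLower y)) f = chirpS (y • b) f) :
    (2 : ℝ) * ((η * (e.eP - e.eQ) : ℤ) : ℝ) = -(LinearMap.toMatrix' b).trace := by
  have hw : ω (φ RotationThreeShears.slWeyl) (hermitePi 0) =
      cexp (I * ((η * (e.eP - e.eQ) : ℤ) : ℂ) * ((π / 2 : ℝ) : ℂ)) • hermitePi 0 := by
    rw [RotationThreeShears.slWeyl_eq_slRot, hφ, hvac, vacScalar_suCircle_zmul]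
  have hχ : ∀ᶠ θ in 𝓝 (0 : ℝ), ω (φ (RotationThreeShears.slRot θ)) (hermitePi 0) =
      cexp (I * ((η * (e.eP - e.eQ) : ℤ) : ℂ) * (θ : ℂ)) • hermitePi 0 :=
    Filter.Eventually.of_forall fun θ => by rw [hφ, hvac, vacScalar_suCircle_zmul]
  exact hW.two_mul_weight_eq_neg_trace φ hu (norm_cexp_I_mul_int_mul _ _) hw _ hχ

/-- **Zero-point pin, upper-shear form**: with the UPPER shears `φ U(y)` acting by the chirps,
`2 η (e_P − e_Q) = tr(b)`. [folklore] -/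
theorem two_mul_eP_sub_eQ_eq_trace {ι𝕎 : Ginf →* SpR (DPIdx P Q R S)}
    {ω : Representation ℂ Ginf (SR (DPIdx P Q R S))} (hW : IsArchWeilDatum ι𝕎 ω)
    (κ : DPK P Q R S →* Ginf) (e : VacExponents)
    (hvac : ∀ k : DPK P Q R S, ω (κ k) (hermitePi 0) = vacScalar e k • hermitePi 0)
    (φ : Matrix.SpecialLinearGroup (Fin 2) ℝ →* Ginf) (p₀ : P) (q₀ : Q) (η : ℤ)
    (hφ : ∀ θ : ℝ, φ (RotationThreeShears.slRot θ) = κ (suCircle p₀ q₀ ((η : ℝ) * θ)))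
    {b : (DPIdx P Q R S → ℝ) →ₗ[ℝ] (DPIdx P Q R S → ℝ)}
    (hu : ∀ (y : ℝ) (f : SR (DPIdx P Q R S)),
      ω (φ (RotationThreeShears.slUpper y)) f = chirpS (y • b) f) :
    (2 : ℝ) * ((η * (e.eP - e.eQ) : ℤ) : ℝ) = (LinearMap.toMatrix' b).trace := by
  have hw : ω (φ RotationThreeShears.slWeyl) (hermitePi 0) =
      cexp (I * ((η * (e.eP - e.eQ) : ℤ) : ℂ) * ((π / 2 : ℝ) : ℂ)) • hermitePi 0 := by
    rw [RotationThreeShears.slWeyl_eq_slRot, hφ, hvac, vacScalar_suCircle_zmul]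
  have hχ : ∀ᶠ θ in 𝓝 (0 : ℝ), ω (φ (RotationThreeShears.slRot θ)) (hermitePi 0) =
      cexp (I * ((η * (e.eP - e.eQ) : ℤ) : ℂ) * (θ : ℂ)) • hermitePi 0 :=
    Filter.Eventually.of_forall fun θ => by rw [hφ, hvac, vacScalar_suCircle_zmul]
  exact hW.two_mul_weight_eq_trace φ hu (norm_cexp_I_mul_int_mul _ _) hw _ hχ

/-! ## 3. At the record: `FockVacuumCharacter D e` + symplectic data of `φ` in a rotated Lagrangian frame

The chirp action `hu` is DERIVED (unipotent pin `IsArchWeilDatum.apply_eq_chirpS`,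
`Weil1964/ArchWeilUnipotentPin`) from the symplectic matrices of `φ L(y)` (resp. `φ U(y)`) and of the
split torus element `φ D(½)` (resp. `φ D(2)`), read in the Lagrangian frame obtained from the tree's
`polar (dotPairing (DPIdx P Q R S))` by a unitary change of polarisation `u ∈ U(DPIdx)` (`realifySp u`;
the datum moves along by `IsArchWeilDatum.conj_unitary`, `Weil1964/ArchWeilDatumConj`, and the Gaussian
vacuum with its `K_V × K_W`-scalars is unchanged, `conjRep_unitary_hermitePi_zero`).  A change of frame
is NEEDED: in the tree's own frame `ι𝕎 (φ L(y))` mixes `p` and `q` (for the `SU(1,1)` of a hyperbolic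
plane `ℂv⁺ ⊕ ℂv⁻` it is a Siegel unipotent only after the `U(2)`-rotation
`(z⁺, z⁻) ↦ ((z⁺+z⁻)/√2, i(z⁺−z⁻)/√2)` of the two complex coordinates of the plane).  So the hypotheses
left are the print row `FockVacuumCharacter D e`, the circle identity `hφ` in `K_V × K_W`, and MATRIX
IDENTITIES in `Sp(𝕎)` about `realifySp u · D.ι𝕎 (φ ·) · (realifySp u)⁻¹`. -/

/-- **Record-level pin, lower-shear form.**  `FockVacuumCharacter D e`, an `SL(2,ℝ)` in `Ginf` whose
rotations are the compact circle `D.κ (suCircle p₀ q₀ (η ·))`, and a unitary frame `u` in which its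
lower shears are the Siegel unipotents of a symmetric direction `b` and its `D(½)` is a split-torus
element `(a, d')` with `d' b a⁻¹ = 4b`, force `2 η (e_P − e_Q) = −tr(b)`. [folklore] -/
theorem RealDualPairJunction.FockVacuumCharacter.two_mul_zmul_eP_sub_eQ_eq_neg_trace
    {D : RealDualPairJunction P Q R S Ginf} {e : VacExponents} (h : D.FockVacuumCharacter e)
    (φ : Matrix.SpecialLinearGroup (Fin 2) ℝ →* Ginf) (p₀ : P) (q₀ : Q) (η : ℤ)
    (hφ : ∀ θ : ℝ, φ (RotationThreeShears.slRot θ) = D.κ (suCircle p₀ q₀ ((η : ℝ) * θ)))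
    (u : Matrix.unitaryGroup (DPIdx P Q R S) ℂ)
    {b : (DPIdx P Q R S → ℝ) →ₗ[ℝ] (DPIdx P Q R S → ℝ)}
    (hb : ∀ x x' : DPIdx P Q R S → ℝ, x ⬝ᵥ b x' = x' ⬝ᵥ b x)
    (hιu : ∀ (y : ℝ) (p q : DPIdx P Q R S → ℝ),
      (realifySp (DPIdx P Q R S) u * D.ι𝕎 (φ (RotationThreeShears.slLower y)) *
        (realifySp (DPIdx P Q R S) u)⁻¹).1 (p, q) = (p, q + (y • b) p))
    {a d' : (DPIdx P Q R S → ℝ) ≃ₗ[ℝ] (DPIdx P Q R S → ℝ)}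
    (had : ∀ x y : DPIdx P Q R S → ℝ, a x ⬝ᵥ d' y = x ⬝ᵥ y)
    (hιd : ∀ p q : DPIdx P Q R S → ℝ,
      (realifySp (DPIdx P Q R S) u *
        D.ι𝕎 (φ (RotationThreeShears.slDiag 2⁻¹ (inv_ne_zero two_ne_zero))) *
        (realifySp (DPIdx P Q R S) u)⁻¹).1 (p, q) = (a p, d' q))
    (hc : (d' : (DPIdx P Q R S → ℝ) →ₗ[ℝ] (DPIdx P Q R S → ℝ)) ∘ₗ b ∘ₗ
        (a.symm : (DPIdx P Q R S → ℝ) →ₗ[ℝ] (DPIdx P Q R S → ℝ)) = (4 : ℝ) • b) :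
    (2 : ℝ) * ((η * (e.eP - e.eQ) : ℤ) : ℝ) = -(LinearMap.toMatrix' b).trace := by
  obtain ⟨ω, hW, hvac⟩ := h
  have hW' := hW.conj_unitary u
  have hvac' : ∀ k : DPK P Q R S, conjRep (unitaryEquivPi u).toLinearEquiv ω (D.κ k) (hermitePi 0) =
      vacScalar e k • hermitePi 0 :=
    fun k => IsArchWeilDatum.conjRep_unitary_hermitePi_zero u (hvac k)
  have hu : ∀ (y : ℝ) (f : SR (DPIdx P Q R S)),
      conjRep (unitaryEquivPi u).toLinearEquiv ω (φ (RotationThreeShears.slLower y)) f =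
        chirpS (y • b) f :=
    hW'.apply_eq_chirpS hb (u := fun y => φ (RotationThreeShears.slLower y))
      (fun y y' => by simp only [RotationThreeShears.slLower_add, map_mul]) (fun y p q => hιu y p q)
      had hιd (n := 4) (by norm_num) (by simpa using hc) (fun y => by
        rw [← map_inv, ← map_mul, ← map_mul, RotationThreeShears.slDiag_conj_slLower]
        norm_num)
  exact two_mul_eP_sub_eQ_eq_neg_trace hW' D.κ e hvac' φ p₀ q₀ η hφ hu

/-- **Record-level pin, upper-shear form** (split torus element `φ D(2)`): `2 η (e_P − e_Q) = tr(b)`.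
[folklore] -/
theorem RealDualPairJunction.FockVacuumCharacter.two_mul_zmul_eP_sub_eQ_eq_trace
    {D : RealDualPairJunction P Q R S Ginf} {e : VacExponents} (h : D.FockVacuumCharacter e)
    (φ : Matrix.SpecialLinearGroup (Fin 2) ℝ →* Ginf) (p₀ : P) (q₀ : Q) (η : ℤ)
    (hφ : ∀ θ : ℝ, φ (RotationThreeShears.slRot θ) = D.κ (suCircle p₀ q₀ ((η : ℝ) * θ)))
    (u : Matrix.unitaryGroup (DPIdx P Q R S) ℂ)
    {b : (DPIdx P Q R S → ℝ) →ₗ[ℝ] (DPIdx P Q R S → ℝ)}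
    (hb : ∀ x x' : DPIdx P Q R S → ℝ, x ⬝ᵥ b x' = x' ⬝ᵥ b x)
    (hιu : ∀ (y : ℝ) (p q : DPIdx P Q R S → ℝ),
      (realifySp (DPIdx P Q R S) u * D.ι𝕎 (φ (RotationThreeShears.slUpper y)) *
        (realifySp (DPIdx P Q R S) u)⁻¹).1 (p, q) = (p, q + (y • b) p))
    {a d' : (DPIdx P Q R S → ℝ) ≃ₗ[ℝ] (DPIdx P Q R S → ℝ)}
    (had : ∀ x y : DPIdx P Q R S → ℝ, a x ⬝ᵥ d' y = x ⬝ᵥ y)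
    (hιd : ∀ p q : DPIdx P Q R S → ℝ,
      (realifySp (DPIdx P Q R S) u * D.ι𝕎 (φ (RotationThreeShears.slDiag 2 two_ne_zero)) *
        (realifySp (DPIdx P Q R S) u)⁻¹).1 (p, q) = (a p, d' q))
    (hc : (d' : (DPIdx P Q R S → ℝ) →ₗ[ℝ] (DPIdx P Q R S → ℝ)) ∘ₗ b ∘ₗ
        (a.symm : (DPIdx P Q R S → ℝ) →ₗ[ℝ] (DPIdx P Q R S → ℝ)) = (4 : ℝ) • b) :
    (2 : ℝ) * ((η * (e.eP - e.eQ) : ℤ) : ℝ) = (LinearMap.toMatrix' b).trace := by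
  obtain ⟨ω, hW, hvac⟩ := h
  have hW' := hW.conj_unitary u
  have hvac' : ∀ k : DPK P Q R S, conjRep (unitaryEquivPi u).toLinearEquiv ω (D.κ k) (hermitePi 0) =
      vacScalar e k • hermitePi 0 :=
    fun k => IsArchWeilDatum.conjRep_unitary_hermitePi_zero u (hvac k)
  have hu : ∀ (y : ℝ) (f : SR (DPIdx P Q R S)),
      conjRep (unitaryEquivPi u).toLinearEquiv ω (φ (RotationThreeShears.slUpper y)) f =
        chirpS (y • b) f :=
    hW'.apply_eq_chirpS hb (u := fun y => φ (RotationThreeShears.slUpper y))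
      (fun y y' => by simp only [RotationThreeShears.slUpper_add, map_mul]) (fun y p q => hιu y p q)
      had hιd (n := 4) (by norm_num) (by simpa using hc) (fun y => by
        rw [← map_inv, ← map_mul, ← map_mul, RotationThreeShears.slDiag_conj_slUpper]
        norm_num)
  exact two_mul_eP_sub_eQ_eq_trace hW' D.κ e hvac' φ p₀ q₀ η hφ hu

end Literature.RepresentationTheory.KonnoKonno2007

/-! ## 4. Projection form: `b` an orthogonal projection, `φ D(½)` acting by `(p − ½ b p, q + b q)` -/

namespace Literature.RepresentationTheory.KonnoKonno2007

open Literature.Analysis.SegalBargmann Literature.RepresentationTheory.HeisenbergGroup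
open Literature.NumberTheory.Weil1964 Literature.LinearAlgebra.Matrix

section Projection

variable {σ : Type*}

/-- the split-torus factor `1 − ½ b` (`= ½` on the range of an idempotent `b`, `= 1` on its kernel).
[folklore] -/
def halfMap (b : (σ → ℝ) →ₗ[ℝ] (σ → ℝ)) : (σ → ℝ) →ₗ[ℝ] (σ → ℝ) := LinearMap.id - (2⁻¹ : ℝ) • b

/-- the split-torus factor `1 + b` (`= 2` on the range of an idempotent `b`, `= 1` on its kernel).
[folklore] -/
def doubleMap (b : (σ → ℝ) →ₗ[ℝ] (σ → ℝ)) : (σ → ℝ) →ₗ[ℝ] (σ → ℝ) := LinearMap.id + b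

/-- unfolding `halfMap`. [folklore] -/
@[simp] theorem halfMap_apply (b : (σ → ℝ) →ₗ[ℝ] (σ → ℝ)) (x : σ → ℝ) : halfMap b x = x - (2⁻¹ : ℝ) • b x := rfl

/-- unfolding `doubleMap`. [folklore] -/
@[simp] theorem doubleMap_apply (b : (σ → ℝ) →ₗ[ℝ] (σ → ℝ)) (x : σ → ℝ) : doubleMap b x = x + b x := rfl

/-- for an idempotent `b`: `(1 − ½ b) ∘ (1 + b) = 1`. [folklore] -/
theorem halfMap_comp_doubleMap (b : (σ → ℝ) →ₗ[ℝ] (σ → ℝ)) (hb2 : b ∘ₗ b = b) :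
    halfMap b ∘ₗ doubleMap b = LinearMap.id := by
  ext1 x
  have h : b (b x) = b x := by simpa using LinearMap.congr_fun hb2 x
  simp only [LinearMap.coe_comp, Function.comp_apply, doubleMap_apply, halfMap_apply, map_add, h,
    LinearMap.id_apply]
  module

/-- for an idempotent `b`: `(1 + b) ∘ (1 − ½ b) = 1`. [folklore] -/
theorem doubleMap_comp_halfMap (b : (σ → ℝ) →ₗ[ℝ] (σ → ℝ)) (hb2 : b ∘ₗ b = b) :
    doubleMap b ∘ₗ halfMap b = LinearMap.id := by
  ext1 x
  have h : b (b x) = b x := by simpa using LinearMap.congr_fun hb2 x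
  simp only [LinearMap.coe_comp, Function.comp_apply, doubleMap_apply, halfMap_apply, map_sub, map_smul, h,
    LinearMap.id_apply]
  module

/-- `1 − ½ b` as a linear automorphism with inverse `1 + b` (`b` idempotent). [folklore] -/
def projHalf (b : (σ → ℝ) →ₗ[ℝ] (σ → ℝ)) (hb2 : b ∘ₗ b = b) : (σ → ℝ) ≃ₗ[ℝ] (σ → ℝ) :=
  LinearEquiv.ofLinear (halfMap b) (doubleMap b) (halfMap_comp_doubleMap b hb2) (doubleMap_comp_halfMap b hb2)

/-- `1 + b` as a linear automorphism with inverse `1 − ½ b` (`b` idempotent). [folklore] -/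
def projDouble (b : (σ → ℝ) →ₗ[ℝ] (σ → ℝ)) (hb2 : b ∘ₗ b = b) : (σ → ℝ) ≃ₗ[ℝ] (σ → ℝ) :=
  LinearEquiv.ofLinear (doubleMap b) (halfMap b) (doubleMap_comp_halfMap b hb2) (halfMap_comp_doubleMap b hb2)

/-- unfolding `projHalf`. [folklore] -/
@[simp] theorem projHalf_apply (b : (σ → ℝ) →ₗ[ℝ] (σ → ℝ)) (hb2 : b ∘ₗ b = b) (x : σ → ℝ) :
    projHalf b hb2 x = x - (2⁻¹ : ℝ) • b x := rfl

/-- unfolding `projDouble`. [folklore] -/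
@[simp] theorem projDouble_apply (b : (σ → ℝ) →ₗ[ℝ] (σ → ℝ)) (hb2 : b ∘ₗ b = b) (x : σ → ℝ) :
    projDouble b hb2 x = x + b x := rfl

/-- unfolding `(projHalf b)⁻¹ = 1 + b`. [folklore] -/
@[simp] theorem projHalf_symm_apply (b : (σ → ℝ) →ₗ[ℝ] (σ → ℝ)) (hb2 : b ∘ₗ b = b) (x : σ → ℝ) :
    (projHalf b hb2).symm x = x + b x := rfl

/-- the dilation identity `(1 + b) ∘ b ∘ (1 − ½ b)⁻¹ = 4 b` for an idempotent `b`. [folklore] -/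
theorem projDouble_comp_comp_projHalf_symm (b : (σ → ℝ) →ₗ[ℝ] (σ → ℝ)) (hb2 : b ∘ₗ b = b) :
    (projDouble b hb2 : (σ → ℝ) →ₗ[ℝ] (σ → ℝ)) ∘ₗ b ∘ₗ ((projHalf b hb2).symm : (σ → ℝ) →ₗ[ℝ] (σ → ℝ)) =
      (4 : ℝ) • b := by
  have h2 : ∀ z, b (b z) = b z := fun z => by simpa using LinearMap.congr_fun hb2 z
  ext1 x
  simp only [LinearMap.coe_comp, LinearEquiv.coe_coe, Function.comp_apply, projHalf_symm_apply, map_add, h2,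
    projDouble_apply, LinearMap.smul_apply]
  module

variable [Fintype σ]

/-- `1 − ½ b` and `1 + b` are dual for the dot product when `b` is a symmetric idempotent:
`(x − ½ b x)·(y + b y) = x·y`. [folklore] -/
theorem projHalf_dotProduct_projDouble (b : (σ → ℝ) →ₗ[ℝ] (σ → ℝ)) (hb : ∀ x x' : σ → ℝ, x ⬝ᵥ b x' = x' ⬝ᵥ b x)
    (hb2 : b ∘ₗ b = b) (x y : σ → ℝ) : projHalf b hb2 x ⬝ᵥ projDouble b hb2 y = x ⬝ᵥ y := by
  have h2 : ∀ z, b (b z) = b z := fun z => by simpa using LinearMap.congr_fun hb2 z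
  have h1 : x ⬝ᵥ b y = b x ⬝ᵥ y := by rw [hb, dotProduct_comm]
  have h3 : b x ⬝ᵥ b y = b x ⬝ᵥ y := by rw [dotProduct_comm, ← hb, h2, h1]  -- (b y)·(b x) = x · b (b y)
  simp only [projHalf_apply, projDouble_apply, sub_dotProduct, dotProduct_add, smul_dotProduct, smul_eq_mul, h1, h3]
  ring

end Projection

variable {P Q R S : Type*} [Fintype P] [DecidableEq P] [Fintype Q] [DecidableEq Q] [Fintype R]
  [DecidableEq R] [Fintype S] [DecidableEq S] {Ginf : Type*} [Group Ginf] [TopologicalSpace Ginf]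

/-- **Projection form of the junction pin.** If, in some unitary frame `u`, the lower shears `φ L(y)`
act on `𝕎` by the Siegel unipotents `(p, q + y b p)` of a symmetric idempotent `b` (an orthogonal
projection) and the split torus element `φ D(½)` by `(p − ½ b p, q + b q)` (i.e. `(½ p, 2 q)` on the
range of `b`, trivially on its kernel), then `2η(e_P − e_Q) = −tr(b)`. [folklore] -/
theorem RealDualPairJunction.FockVacuumCharacter.two_mul_zmul_eP_sub_eQ_eq_neg_trace_of_proj
    {D : RealDualPairJunction P Q R S Ginf} {e : VacExponents} (h : D.FockVacuumCharacter e)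
    (φ : Matrix.SpecialLinearGroup (Fin 2) ℝ →* Ginf) (p₀ : P) (q₀ : Q) (η : ℤ)
    (hφ : ∀ θ : ℝ, φ (RotationThreeShears.slRot θ) = D.κ (suCircle p₀ q₀ ((η : ℝ) * θ)))
    (u : Matrix.unitaryGroup (DPIdx P Q R S) ℂ) {b : (DPIdx P Q R S → ℝ) →ₗ[ℝ] (DPIdx P Q R S → ℝ)}
    (hb : ∀ x x' : DPIdx P Q R S → ℝ, x ⬝ᵥ b x' = x' ⬝ᵥ b x) (hb2 : b ∘ₗ b = b)
    (hιu : ∀ (y : ℝ) (p q : DPIdx P Q R S → ℝ),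
      (realifySp (DPIdx P Q R S) u * D.ι𝕎 (φ (RotationThreeShears.slLower y)) *
        (realifySp (DPIdx P Q R S) u)⁻¹).1 (p, q) = (p, q + (y • b) p))
    (hιd : ∀ p q : DPIdx P Q R S → ℝ,
      (realifySp (DPIdx P Q R S) u * D.ι𝕎 (φ (RotationThreeShears.slDiag 2⁻¹ (inv_ne_zero two_ne_zero))) *
        (realifySp (DPIdx P Q R S) u)⁻¹).1 (p, q) = (p - (2⁻¹ : ℝ) • b p, q + b q)) :
    (2 : ℝ) * ((η * (e.eP - e.eQ) : ℤ) : ℝ) = -(LinearMap.toMatrix' b).trace :=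
  h.two_mul_zmul_eP_sub_eQ_eq_neg_trace φ p₀ q₀ η hφ u hb hιu (a := projHalf b hb2) (d' := projDouble b hb2)
    (projHalf_dotProduct_projDouble b hb hb2) (fun p q => by rw [hιd, projHalf_apply, projDouble_apply])
    (projDouble_comp_comp_projHalf_symm b hb2)

/-- **Hyperbolic-plane form.** With `b` a symmetric idempotent of trace `2` (the two real coordinates of a
hyperbolic plane `ℂv⁺ ⊕ ℂv⁻` tensored with a line), `η (e_P − e_Q) = −1`. [folklore] -/
theorem RealDualPairJunction.FockVacuumCharacter.zmul_eP_sub_eQ_eq_neg_one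
    {D : RealDualPairJunction P Q R S Ginf} {e : VacExponents} (h : D.FockVacuumCharacter e)
    (φ : Matrix.SpecialLinearGroup (Fin 2) ℝ →* Ginf) (p₀ : P) (q₀ : Q) (η : ℤ)
    (hφ : ∀ θ : ℝ, φ (RotationThreeShears.slRot θ) = D.κ (suCircle p₀ q₀ ((η : ℝ) * θ)))
    (u : Matrix.unitaryGroup (DPIdx P Q R S) ℂ) {b : (DPIdx P Q R S → ℝ) →ₗ[ℝ] (DPIdx P Q R S → ℝ)}
    (hb : ∀ x x' : DPIdx P Q R S → ℝ, x ⬝ᵥ b x' = x' ⬝ᵥ b x) (hb2 : b ∘ₗ b = b)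
    (htr : (LinearMap.toMatrix' b).trace = 2)
    (hιu : ∀ (y : ℝ) (p q : DPIdx P Q R S → ℝ),
      (realifySp (DPIdx P Q R S) u * D.ι𝕎 (φ (RotationThreeShears.slLower y)) *
        (realifySp (DPIdx P Q R S) u)⁻¹).1 (p, q) = (p, q + (y • b) p))
    (hιd : ∀ p q : DPIdx P Q R S → ℝ,
      (realifySp (DPIdx P Q R S) u * D.ι𝕎 (φ (RotationThreeShears.slDiag 2⁻¹ (inv_ne_zero two_ne_zero))) *
        (realifySp (DPIdx P Q R S) u)⁻¹).1 (p, q) = (p - (2⁻¹ : ℝ) • b p, q + b q)) :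
    η * (e.eP - e.eQ) = -1 := by
  have h2 := h.two_mul_zmul_eP_sub_eQ_eq_neg_trace_of_proj φ p₀ q₀ η hφ u hb hb2 hιu hιd
  rw [htr] at h2
  have h3 : ((η * (e.eP - e.eQ) : ℤ) : ℝ) = -1 := by linarith
  exact_mod_cast h3

end Literature.RepresentationTheory.KonnoKonno2007

/-! ## 5. Signed-projection form: `b P = P b = b` for a symmetric idempotent `P`
(`b = P_S − P_R` on the planes of a hyperbolic plane tensored with a space of signature `(|R|, |S|)`) -/

namespace Literature.RepresentationTheory.KonnoKonno2007

open Literature.Analysis.SegalBargmann Literature.RepresentationTheory.HeisenbergGroup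
open Literature.NumberTheory.Weil1964 Literature.LinearAlgebra.Matrix

section SignedProjection

variable {σ : Type*}

/-- the dilation identity `(1 + P) ∘ b ∘ (1 − ½ P)⁻¹ = 4 b` for an idempotent `P` absorbing `b` on both
sides (`b ∘ P = b = P ∘ b`; e.g. `b = P_S − P_R`, `P = P_S + P_R`). [folklore] -/
theorem projDouble_comp_comp_projHalf_symm_of_absorb (P : (σ → ℝ) →ₗ[ℝ] (σ → ℝ)) (hP2 : P ∘ₗ P = P)
    (b : (σ → ℝ) →ₗ[ℝ] (σ → ℝ)) (hbP : b ∘ₗ P = b) (hPb : P ∘ₗ b = b) :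
    (projDouble P hP2 : (σ → ℝ) →ₗ[ℝ] (σ → ℝ)) ∘ₗ b ∘ₗ ((projHalf P hP2).symm : (σ → ℝ) →ₗ[ℝ] (σ → ℝ)) =
      (4 : ℝ) • b := by
  have h1 : ∀ z, b (P z) = b z := fun z => by simpa using LinearMap.congr_fun hbP z
  have h2 : ∀ z, P (b z) = b z := fun z => by simpa using LinearMap.congr_fun hPb z
  ext1 x
  simp only [LinearMap.coe_comp, LinearEquiv.coe_coe, Function.comp_apply, projHalf_symm_apply, map_add, h1,
    projDouble_apply, h2, LinearMap.smul_apply]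
  module

end SignedProjection

variable {P Q R S : Type*} [Fintype P] [DecidableEq P] [Fintype Q] [DecidableEq Q] [Fintype R]
  [DecidableEq R] [Fintype S] [DecidableEq S] {Ginf : Type*} [Group Ginf] [TopologicalSpace Ginf]

/-- **Signed-projection form of the junction pin.** If, in some unitary frame `u`, the lower shears
`φ L(y)` act by the Siegel unipotents `(p, q + y b p)` of a symmetric `b` absorbed by a symmetric
idempotent `Π` (`b Π = Π b = b`, e.g. `b = Π_S − Π_R`, `Π = Π_S + Π_R`), and the split torus element
`φ D(½)` acts by `(p − ½ Π p, q + Π q)`, then `2η(e_P − e_Q) = −tr(b)` (for `b = Π_S − Π_R` on the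
`2|R| + 2|S|` real coordinates of a hyperbolic plane of `V` tensored with `W` of signature `(|R|, |S|)`:
`η(e_P − e_Q) = |R| − |S|`). [folklore] -/
theorem RealDualPairJunction.FockVacuumCharacter.two_mul_zmul_eP_sub_eQ_eq_neg_trace_of_absorb
    {D : RealDualPairJunction P Q R S Ginf} {e : VacExponents} (h : D.FockVacuumCharacter e)
    (φ : Matrix.SpecialLinearGroup (Fin 2) ℝ →* Ginf) (p₀ : P) (q₀ : Q) (η : ℤ)
    (hφ : ∀ θ : ℝ, φ (RotationThreeShears.slRot θ) = D.κ (suCircle p₀ q₀ ((η : ℝ) * θ)))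
    (u : Matrix.unitaryGroup (DPIdx P Q R S) ℂ) {b Pj : (DPIdx P Q R S → ℝ) →ₗ[ℝ] (DPIdx P Q R S → ℝ)}
    (hb : ∀ x x' : DPIdx P Q R S → ℝ, x ⬝ᵥ b x' = x' ⬝ᵥ b x)
    (hPj : ∀ x x' : DPIdx P Q R S → ℝ, x ⬝ᵥ Pj x' = x' ⬝ᵥ Pj x) (hPj2 : Pj ∘ₗ Pj = Pj)
    (hbPj : b ∘ₗ Pj = b) (hPjb : Pj ∘ₗ b = b)
    (hιu : ∀ (y : ℝ) (p q : DPIdx P Q R S → ℝ),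
      (realifySp (DPIdx P Q R S) u * D.ι𝕎 (φ (RotationThreeShears.slLower y)) *
        (realifySp (DPIdx P Q R S) u)⁻¹).1 (p, q) = (p, q + (y • b) p))
    (hιd : ∀ p q : DPIdx P Q R S → ℝ,
      (realifySp (DPIdx P Q R S) u * D.ι𝕎 (φ (RotationThreeShears.slDiag 2⁻¹ (inv_ne_zero two_ne_zero))) *
        (realifySp (DPIdx P Q R S) u)⁻¹).1 (p, q) = (p - (2⁻¹ : ℝ) • Pj p, q + Pj q)) :
    (2 : ℝ) * ((η * (e.eP - e.eQ) : ℤ) : ℝ) = -(LinearMap.toMatrix' b).trace :=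
  h.two_mul_zmul_eP_sub_eQ_eq_neg_trace φ p₀ q₀ η hφ u hb hιu (a := projHalf Pj hPj2) (d' := projDouble Pj hPj2)
    (projHalf_dotProduct_projDouble Pj hPj hPj2) (fun p q => by rw [hιd, projHalf_apply, projDouble_apply])
    (projDouble_comp_comp_projHalf_symm_of_absorb Pj hPj2 b hbPj hPjb)

end Literature.RepresentationTheory.KonnoKonno2007
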